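import Literature.Computability.AlgebraicComplexity.Hyperdeterminant
import Literature.Computability.AlgebraicComplexity.ValiantCompleteness
import Literature.Computability.AlgebraicComplexity.ValiantClasses

/-!
# `DetqpThesis` (stmt-ValiantsHypothesis-0315), line `Sketch` (idea four-dimensional-determinant) —
# stub S3: the generic four-dimensional hyperdeterminant is a p-projection of the permanent

Completeness transfer.  Write `HD_n := hyperdet (fun I : Fin 4 → Fin n => X I)` for the generic
Cayley hyperdeterminant of format `n × n × n × n` over `ℂ` (tree `hyperdet`).  Given `HD ∈ VNP`
(the hypothesis, stub S2 of the line), `HD` is a p-projection of the permanent family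
`(PER_n)_n`, by Valiant's completeness theorem PROVED in tree (`isVNPComplete_perPoly_holds`,
`ringChar ℂ = 0 ≠ 2`).  Since completeness quantifies over families in the variables `Fin (v n)`,
we first bundle `HD_n` along `Fintype.equivFin (Fin 4 → Fin n)` (`isVNPFamily_renameEquiv_iff`)
and come back by the inverse renaming, which is itself a Valiant projection
(`isProjection_rename_vars`), composed with `IsProjection.trans_holds` at the same p-bounded `t`.
-/

noncomputable section

-- single-conjunct layout: Sub = Summit, duplicated namespace component intended
set_option linter.dupNamespace false

namespace Summit.ValiantsHypothesis.ValiantsHypothesis.Theorems.DetQPDetqpThesis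

open Literature.Computability.AlgebraicComplexity MvPolynomial

/-- Renaming the variables is a Valiant projection: `rename φ f = f (X (φ i))_i`, every substituted
entry being a variable (Bürgisser 2000, Def. 2.6(1)). -/
theorem isProjection_rename_vars {σ τ : Type*} (φ : σ → τ) (f : MvPolynomial σ ℂ) :
    IsProjection (rename φ f) f :=
  have hφ : (rename φ : MvPolynomial σ ℂ →ₐ[ℂ] MvPolynomial τ ℂ) = aeval fun i => X (φ i) :=
    MvPolynomial.algHom_ext fun i => by simp
  ⟨fun i => X (φ i), fun i => Or.inl ⟨φ i, rfl⟩, DFunLike.congr_fun hφ f⟩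

/-- Un-bundling is a projection: `f` is a projection of `renameEquiv ℂ e f` (rename back along
`e.symm`; `rename e.symm ∘ rename e = rename id = id`). -/
theorem isProjection_renameEquiv_symm {σ τ : Type*} (e : σ ≃ τ) (f : MvPolynomial σ ℂ) :
    IsProjection f (renameEquiv ℂ e f) := by
  have h := isProjection_rename_vars e.symm (renameEquiv ℂ e f)
  rwa [MvPolynomial.renameEquiv_apply, MvPolynomial.rename_rename, Equiv.symm_comp_self,
    MvPolynomial.rename_id_apply] at h

/-- **S3 — completeness transfer.**  If the generic four-dimensional hyperdeterminant family
`HD_n = hyperdet (X_I)_{I : Fin 4 → Fin n}` is in `VNP` over `ℂ`, then it is a p-projection of the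
permanent family: bundle the variables `Fin 4 → Fin n` into `Fin (n⁴)` along `Fintype.equivFin`
(`isVNPFamily_renameEquiv_iff`), apply Valiant's theorem `isVNPComplete_perPoly_holds ℂ`
(`ringChar ℂ = 0 ≠ 2`), and rename back (`isProjection_renameEquiv_symm`,
`IsProjection.trans_holds`), keeping the same p-bounded size function `t`. -/
theorem stub_isPProjection_hyperdet_perPoly
    (h : IsVNPFamily (fun n => hyperdet (fun I : Fin 4 → Fin n => (X I : MvPolynomial (Fin 4 → Fin n) ℂ)))) :
    IsPProjection (fun n => hyperdet (fun I : Fin 4 → Fin n => (X I : MvPolynomial (Fin 4 → Fin n) ℂ)))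
      (fun n => perPoly (Fin n) ℂ) := by
  set e : ∀ n, (Fin 4 → Fin n) ≃ Fin (Fintype.card (Fin 4 → Fin n)) := fun n => Fintype.equivFin _
  have hg : IsVNPFamily (fun n => renameEquiv ℂ (e n)
      (hyperdet (fun I : Fin 4 → Fin n => (X I : MvPolynomial (Fin 4 → Fin n) ℂ)))) :=
    (isVNPFamily_renameEquiv_iff e _).2 h
  have h2 : ringChar ℂ ≠ 2 := by rw [ringChar.eq_zero]; decide
  obtain ⟨t, ht, hproj⟩ := (isVNPComplete_perPoly_holds ℂ h2).2 _ _ hg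
  exact ⟨t, ht, fun n => IsProjection.trans_holds (isProjection_renameEquiv_symm (e n) _) (hproj n)⟩

end Summit.ValiantsHypothesis.ValiantsHypothesis.Theorems.DetQPDetqpThesis

end
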